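import Summits.BirchSwinnertonDyer.BirchSwinnertonDyer.Theorems.TameQuarticSolventTprimeNoThreeTorsionNumberField
import HarnessLib

/-!
# Route `TameQuarticSolvent`, crux `SolventPairLowerBound` (stmt-BirchSwinnertonDyer-21391) — `E(M)[3] = 0` on sub-row B
# of the (t′) leaf, in the VERBATIM vocabulary of the K1⁻ item 23963 (`w : HeightOneSpectrum (𝓞 M)`,
# `(3 : 𝓞 M) ∈ w.asIdeal`, `w.asIdeal.ramificationIdx ℤ = 4`)

HONEST FRAMING. Theorems only; helper (`--supports stmt-BirchSwinnertonDyer-21391 --as helper`) of width seat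
bsd-wall-tqs-p1-w2 g7; bookkeeping bridge from the K-PORT / FLT-packet phrasing of
`tprime_threeTorsion_numberField_eq_zero_of_locIrr` (p605486: `w : (primesEquiv.symm 3).Extension (𝓞 M)`,
ramification index over `𝓞 ℚ`) to the phrasing of `LowerBSD3OverSolventQuartic` (stmt-BirchSwinnertonDyer-23963):
places `w : HeightOneSpectrum (𝓞 M)` with `((3 : ℕ) : 𝓞 M) ∈ w.asIdeal` and `w.asIdeal.ramificationIdx ℤ`. BSD is not
proved by any of this; nothing here closes 21391 or 23963.

WHAT.
* `under_ringOfIntegers_eq_of_three_mem` — a place of `𝓞 M` containing `3` lies over the place `3` of `𝓞 ℚ`;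
* `ramificationIdx_int_eq_ramificationIdx_ringOfIntegers_of_three_mem` — its ramification index over `ℤ` equals the
  one over `𝓞 ℚ` (both count the multiplicity of `w` in `(3) = 3·𝓞 M`);
* `tprime_threeTorsion_numberField_eq_zero_of_locIrr_at` — (t′) at `3`, `LocIrr W 3`, `M` a number field, `w` a place
  with `3 ∈ w` and `e(w∣3) = 4·(odd)` over `ℤ` ⇒ `3 • P = 0 → P = 0` on `(W ⊗ M)(M)`;
* `tprime_threeTorsion_numberField_eq_zero_of_locIrr_of_forall_ramificationIdx` — the same under 23963's hypothesis
  VERBATIM: `∀ w, ((3 : ℕ) : 𝓞 M) ∈ w.asIdeal → w.asIdeal.ramificationIdx ℤ = 4` (a place over `3` exists).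

References: J. Neukirch, *Algebraic Number Theory* I §8 (primes over primes); J.-P. Serre, Invent. Math. 15 (1972) §1.
[cite: SilvermanAEC2009, IV.6.1]
-/

-- D-0017: single-problem summit, so `Summit.BirchSwinnertonDyer.BirchSwinnertonDyer.…` repeats a namespace BY DESIGN.
set_option linter.dupNamespace false

noncomputable section

namespace Summit.BirchSwinnertonDyer.BirchSwinnertonDyer.Theorems.SolventPairLowerBound

open WeierstrassCurve Literature.NumberTheory.EllipticCurves.Rank1Residual
  Summit.BirchSwinnertonDyer.Rank1Residual.Additive NumberField IsDedekindDomain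

section Places

variable (M : Type) [Field M] [NumberField M]

/-- The place `3` of `𝓞 ℚ` is the ideal `(3)`. [folklore] -/
theorem asIdeal_primesEquiv_symm_three :
    ((Rat.HeightOneSpectrum.primesEquiv (R := 𝓞 ℚ)).symm ⟨3, Nat.prime_three⟩).asIdeal =
      Ideal.span {((3 : ℕ) : 𝓞 ℚ)} := by
  have hnat : Rat.HeightOneSpectrum.natGenerator
      ((Rat.HeightOneSpectrum.primesEquiv (R := 𝓞 ℚ)).symm ⟨3, Nat.prime_three⟩) = 3 :=
    congrArg Subtype.val ((Rat.HeightOneSpectrum.primesEquiv (R := 𝓞 ℚ)).apply_symm_apply ⟨3, Nat.prime_three⟩)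
  rw [Literature.NumberTheory.DiophantineGeometry.UniformABCConjecture.asIdeal_eq_span_natGenerator, hnat]

/-- **A place of `𝓞 M` containing `3` lies over the place `3` of `𝓞 ℚ`.** [folklore] -/
theorem under_ringOfIntegers_eq_of_three_mem (w : HeightOneSpectrum (𝓞 M))
    (h3 : ((3 : ℕ) : 𝓞 M) ∈ w.asIdeal) :
    w.under (𝓞 ℚ) = (Rat.HeightOneSpectrum.primesEquiv (R := 𝓞 ℚ)).symm ⟨3, Nat.prime_three⟩ := by
  apply HeightOneSpectrum.ext
  rw [asIdeal_primesEquiv_symm_three, HeightOneSpectrum.under_asIdeal]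
  symm
  refine Ideal.IsMaximal.eq_of_le ?_ (Ideal.IsPrime.under _ _).ne_top ?_
  · rw [← asIdeal_primesEquiv_symm_three]; exact HeightOneSpectrum.isMaximal _
  · rw [Ideal.span_le, Set.singleton_subset_iff, SetLike.mem_coe, Ideal.under_def, Ideal.mem_comap, map_natCast]
    exact h3

/-- **The ramification index of a place over `3` is the same over `ℤ` and over `𝓞 ℚ`** (both are the multiplicity
of `w` in `3·𝓞 M`). [folklore] -/
theorem ramificationIdx_int_eq_ramificationIdx_ringOfIntegers_of_three_mem (w : HeightOneSpectrum (𝓞 M))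
    (h3 : ((3 : ℕ) : 𝓞 M) ∈ w.asIdeal) :
    w.asIdeal.ramificationIdx ℤ = w.asIdeal.ramificationIdx (𝓞 ℚ) := by
  classical
  have h30' : ((3 : ℕ) : 𝓞 M) ≠ 0 := by
    intro h
    have h' := congrArg (algebraMap (𝓞 M) M) h
    rw [map_natCast, map_zero] at h'
    exact three_ne_zero (by exact_mod_cast h')
  have h30 : Ideal.span {((3 : ℕ) : 𝓞 M)} ≠ ⊥ := by
    rw [Ne, Ideal.span_singleton_eq_bot]; exact h30'
  -- over `ℤ`: the prime below is `(3)`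
  have hZ' : w.asIdeal.under ℤ = Ideal.span {(3 : ℤ)} := by
    symm
    refine Ideal.IsMaximal.eq_of_le ?_ (Ideal.IsPrime.under _ _).ne_top ?_
    · exact Ideal.IsPrime.isMaximal ((Ideal.span_singleton_prime (by norm_num)).mpr Int.prime_three)
        (by rw [Ne, Ideal.span_singleton_eq_bot]; norm_num)
    · rw [Ideal.span_le, Set.singleton_subset_iff, SetLike.mem_coe, Ideal.under_def, Ideal.mem_comap, map_ofNat]
      exact_mod_cast h3
  have hZ : (w.asIdeal.under ℤ).map (algebraMap ℤ (𝓞 M)) = Ideal.span {((3 : ℕ) : 𝓞 M)} := by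
    rw [hZ', Ideal.map_span, Set.image_singleton, map_ofNat, Nat.cast_ofNat]
  -- over `𝓞 ℚ`: the prime below is `(3)`
  have hQ' : w.asIdeal.under (𝓞 ℚ) = Ideal.span {((3 : ℕ) : 𝓞 ℚ)} := by
    have h := congrArg HeightOneSpectrum.asIdeal (under_ringOfIntegers_eq_of_three_mem M w h3)
    rw [HeightOneSpectrum.under_asIdeal, asIdeal_primesEquiv_symm_three] at h
    exact h
  have hQ : (w.asIdeal.under (𝓞 ℚ)).map (algebraMap (𝓞 ℚ) (𝓞 M)) = Ideal.span {((3 : ℕ) : 𝓞 M)} := by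
    rw [hQ', Ideal.map_span, Set.image_singleton, map_natCast]
  haveI : w.asIdeal.LiesOver (w.asIdeal.under ℤ) := ⟨rfl⟩
  haveI : w.asIdeal.LiesOver (w.asIdeal.under (𝓞 ℚ)) := ⟨rfl⟩
  rw [Ideal.IsDedekindDomain.ramificationIdx_eq_normalizedFactors_count (w.asIdeal.under ℤ) w.asIdeal
      (by rw [hZ]; exact h30),
    Ideal.IsDedekindDomain.ramificationIdx_eq_normalizedFactors_count (w.asIdeal.under (𝓞 ℚ)) w.asIdeal
      (by rw [hQ]; exact h30), hZ, hQ]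

/-- **(t′) at `3`, `E[3]|G_{ℚ₃}` irreducible ⇒ `E(M)[3] = 0`**, for a number field `M` with a place `w ∋ 3` of
ramification `4·(odd)` over `ℤ` (the item-23963 phrasing). [Serre 1972 §1] [cite: SilvermanAEC2009, IV.6.1] -/
theorem tprime_threeTorsion_numberField_eq_zero_of_locIrr_at (W : WeierstrassCurve ℚ) [W.IsElliptic]
    [W.IsGloballyMinimal] (hadd : Addv W 3) (hsub : SubTprime W 3) (hirr : LocIrr W 3)
    (w : HeightOneSpectrum (𝓞 M)) (h3 : ((3 : ℕ) : 𝓞 M) ∈ w.asIdeal)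
    {m' : ℕ} (hm' : Odd m') (he : w.asIdeal.ramificationIdx ℤ = 4 * m') [DecidableEq M]
    (P : (W.baseChange M).toAffine.Point) (h3P : 3 • P = 0) : P = 0 :=
  tprime_threeTorsion_numberField_eq_zero_of_locIrr W hadd hsub hirr M
    ⟨w, under_ringOfIntegers_eq_of_three_mem M w h3⟩ hm'
    (by rw [← ramificationIdx_int_eq_ramificationIdx_ringOfIntegers_of_three_mem M w h3]; exact he) P h3P

/-- **`E(M)[3] = 0` under the ramification hypothesis of `LowerBSD3OverSolventQuartic` (23963) VERBATIM**:
(t′) at `3`, `LocIrr W 3` (= sub-row B, p598630), `M` a number field with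
`∀ w : HeightOneSpectrum (𝓞 M), ((3 : ℕ) : 𝓞 M) ∈ w.asIdeal → w.asIdeal.ramificationIdx ℤ = 4`
⇒ `3 • P = 0 → P = 0` on `(W ⊗ M)(M)` (a place over `3` exists since `𝓞 M` is integral over `ℤ`).
[Serre 1972 §1] [cite: SilvermanAEC2009, IV.6.1] -/
theorem tprime_threeTorsion_numberField_eq_zero_of_locIrr_of_forall_ramificationIdx (W : WeierstrassCurve ℚ)
    [W.IsElliptic] [W.IsGloballyMinimal] (hadd : Addv W 3) (hsub : SubTprime W 3) (hirr : LocIrr W 3)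
    (hram : ∀ w : HeightOneSpectrum (𝓞 M), ((3 : ℕ) : 𝓞 M) ∈ w.asIdeal → w.asIdeal.ramificationIdx ℤ = 4)
    [DecidableEq M] (P : (W.baseChange M).toAffine.Point) (h3P : 3 • P = 0) : P = 0 := by
  -- a place of `𝓞 M` over `3`
  haveI : (Ideal.span {(3 : ℤ)}).IsMaximal :=
    Ideal.IsPrime.isMaximal ((Ideal.span_singleton_prime (by norm_num)).mpr Int.prime_three)
      (by rw [Ne, Ideal.span_singleton_eq_bot]; norm_num)
  obtain ⟨Q, hQmax, hQover⟩ :=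
    Ideal.exists_maximal_ideal_liesOver_of_isIntegral (S := 𝓞 M) (Ideal.span {(3 : ℤ)})
  have h3Q : ((3 : ℕ) : 𝓞 M) ∈ Q := by
    have h : (3 : ℤ) ∈ Q.under ℤ := by
      rw [← hQover.over]; exact Ideal.mem_span_singleton_self _
    rw [Ideal.under_def, Ideal.mem_comap, map_ofNat] at h
    exact_mod_cast h
  have hQ0 : Q ≠ ⊥ := by
    intro h
    rw [h, Ideal.mem_bot] at h3Q
    exact three_ne_zero (by exact_mod_cast h3Q)
  let w : HeightOneSpectrum (𝓞 M) := ⟨Q, hQmax.isPrime, hQ0⟩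
  exact tprime_threeTorsion_numberField_eq_zero_of_locIrr_at M W hadd hsub hirr w h3Q odd_one
    (by rw [mul_one]; exact hram w h3Q) P h3P

end Places

end Summit.BirchSwinnertonDyer.BirchSwinnertonDyer.Theorems.SolventPairLowerBound

end
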